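import Summits.KontsevichZagierPeriods.KontsevichZagierPeriods.Theorems.LinRedNormalFormArrangementNormalFormStubUnletterDefs

/-!
# `ArrangementNormalForm` (stmt-KontsevichZagierPeriods-3915), line `janus-bands`, stub `stub_unletter` — (1/5) lettered simplex integrands

Support file for `stub_unletter` (Janus band representations of base dimension `0` are congruent,
modulo `KZ.relations`, to `ℤ`-combinations of LETTERED ORDER CELLS).  The normal form of the whole
argument is a representation on the open ordered simplex
`Δ_w = KZ.openOrderedSimplex w = {1 > t₀ > ⋯ > t_{w-1} > 0}` with integrand
`cint G a t = G(t) · ∏ᵢ lett (a i) (tᵢ)` (`G` a polynomial over `ℚ`, `a i : Option ℚ` an optional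
simple constant letter, `lett (some c) x = 1/(x - c)`, `lett none x = 1`); the letters are ADMISSIBLE
(`Adm`) when none lies in `(0, 1)`, the top coordinate `t₀` is not lettered `1` and the bottom
coordinate `t_{w-1}` is not lettered `0`.  All helper declarations live in the sub-namespace
`…JanusBands.Unletter`.

This file: basic identities of the class integrand; SUFFICIENCY of admissibility for absolute
convergence on `Δ_w` (`integrableOn_cint`: domination by the MZV-type products of
`KZ.integrableOn_prod_mzvForm`, polynomial weights being bounded); the fibrewise derivative of the
formal primitive (`hasDerivAt_aeval_antider`); the exact division `A - B ∣ H(X, A) - H(X, B)`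
(`sub_dvd_bindSnoc_sub`).

References: M. Kontsevich, D. Zagier, *Periods* (2001), §1.2; D. Zagier, *Values of zeta functions
and their applications* (1994), §9 (convergence of iterated integrals).
-/

noncomputable section

open Set MeasureTheory MvPolynomial
open Literature.NumberTheory.Transcendental
open Literature.ModelTheory.ExponentialFields (IsSemialgebraic)

namespace Summit.KontsevichZagierPeriods.ArrangementNormalForm.JanusBands

/-- Registered support goal of this file: the open ordered simplex has finite volume. -/
theorem unletter_volume_simplex_ne_top (w : ℕ) : MeasureTheory.volume (KZ.openOrderedSimplex w) ≠ ⊤ := by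
  refine (lt_of_le_of_lt (measure_mono fun t ht => ?_) (measure_Icc_lt_top (a := (0 : Fin w → ℝ))
    (b := 1))).ne
  exact ⟨fun i => (ht.1 i).le, fun i => (ht.2.1 i).le⟩

namespace Unletter

/-! ### Letters, the class integrand, admissibility -/

/-- `den` without letter. -/
@[simp] theorem den_none (x : ℝ) : den none x = 1 := rfl

/-- `den` of a letter. -/
@[simp] theorem den_some (c : ℚ) (x : ℝ) : den (some c) x = x - c := rfl

/-- `lett` without letter. -/
@[simp] theorem lett_none (x : ℝ) : lett none x = 1 := by simp [lett]

/-- `lett` of a letter. -/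
@[simp] theorem lett_some (c : ℚ) (x : ℝ) : lett (some c) x = 1 / (x - c) := rfl

/-- Evaluation of the denominator polynomial. -/
theorem aeval_denPoly {w : ℕ} (a : Fin w → Option ℚ) (t : Fin w → ℝ) :
    aeval t (denPoly a) = ∏ i, den (a i) (t i) := by
  rw [denPoly, map_prod]
  refine Finset.prod_congr rfl fun i _ => ?_
  cases a i <;> simp

/-- The class integrand is the rational function `G / denPoly`. -/
theorem cint_eq_div {w : ℕ} (G : MvPolynomial (Fin w) ℚ) (a : Fin w → Option ℚ) (t : Fin w → ℝ) :
    cint G a t = aeval t G / aeval t (denPoly a) := by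
  simp only [cint, lett, aeval_denPoly, div_eq_mul_inv, one_mul, Finset.prod_inv_distrib]

/-- A letter outside `(0, 1)` has a non-vanishing denominator on `(0, 1)`. -/
theorem den_ne_zero_of {o : Option ℚ} {x : ℝ} (hx : x ∈ Ioo (0:ℝ) 1)
    (ho : ∀ c, o = some c → c ≤ 0 ∨ 1 ≤ c) : den o x ≠ 0 := by
  cases o with
  | none => simp
  | some c =>
    rw [den_some, sub_ne_zero]
    rintro rfl
    rcases ho _ rfl with h | h
    · exact absurd hx.1 (not_lt.2 (by exact_mod_cast h))
    · exact absurd hx.2 (not_lt.2 (by exact_mod_cast h))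

/-- Unfolding of admissibility. -/
theorem mem_Adm {w : ℕ} {a : Fin w → Option ℚ} : a ∈ Adm w ↔
    ∀ i c, a i = some c → (c ≤ 0 ∨ 1 ≤ c) ∧ ((i : ℕ) = 0 → c ≠ 1) ∧ ((i : ℕ) + 1 = w → c ≠ 0) :=
  Iff.rfl

/-- On the simplex the denominators of admissible data do not vanish. -/
theorem den_ne_zero_of_adm {w : ℕ} {a : Fin w → Option ℚ} (ha : a ∈ Adm w) {t : Fin w → ℝ}
    (ht : t ∈ KZ.openOrderedSimplex w) (i : Fin w) : den (a i) (t i) ≠ 0 :=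
  den_ne_zero_of ⟨ht.1 i, ht.2.1 i⟩ fun c hc => (ha i c hc).1

/-- The class integrand is `ℚ`-semialgebraic wherever the denominators do not vanish. -/
theorem isSemialgebraicFunOn_cint {w : ℕ} (G : MvPolynomial (Fin w) ℚ) (a : Fin w → Option ℚ)
    {S : Set (Fin w → ℝ)} (hS : IsSemialgebraic ℚ S) (hden : ∀ t ∈ S, ∀ i, den (a i) (t i) ≠ 0) :
    IsSemialgebraicFunOn ℚ S (cint G a) := by
  refine (isSemialgebraicFunOn_aeval_div_aeval hS G (denPoly a) fun t ht => ?_).congr fun t _ => ?_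
  · rw [aeval_denPoly]; exact Finset.prod_ne_zero_iff.2 fun i _ => hden t ht i
  · exact (cint_eq_div G a t).symm

/-- Polynomials are bounded on the simplex. -/
theorem exists_abs_aeval_le {w : ℕ} (G : MvPolynomial (Fin w) ℚ) :
    ∃ C, 0 ≤ C ∧ ∀ t ∈ KZ.openOrderedSimplex w, |(aeval t G : ℝ)| ≤ C := by
  have hcont : Continuous fun t : Fin w → ℝ => (aeval t G : ℝ) := by
    have : (fun t : Fin w → ℝ => (aeval t G : ℝ)) = fun t => eval t (map (algebraMap ℚ ℝ) G) := by
      ext t; rw [eval_map, aeval_def]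
    rw [this]; exact MvPolynomial.continuous_eval _
  obtain ⟨C, hC⟩ := (isCompact_Icc (a := (0 : Fin w → ℝ)) (b := 1)).exists_bound_of_continuousOn
    hcont.continuousOn
  refine ⟨max C 0, le_max_right _ _, fun t ht => (le_trans ?_ (le_max_left _ _))⟩
  simpa using hC t ⟨fun i => (ht.1 i).le, fun i => (ht.2.1 i).le⟩

/-! ### Integrability of admissible integrands -/

/-- `1 ≤ Kb`. -/
theorem one_le_Kb (o : Option ℚ) : 1 ≤ Kb o := by cases o <;> simp [Kb]

/-- `|1/(x - c)| ≤ 1/m` as soon as `0 < m ≤ |x - c|`. -/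
theorem abs_lett_some_le {c : ℚ} {x m : ℝ} (hm : 0 < m) (h : m ≤ |x - c|) :
    |lett (some c) x| ≤ 1 / m := by
  rw [lett_some, abs_div, abs_one]
  exact one_div_le_one_div_of_le hm h

/-- Letters `c ≤ 0` or `c > 1` (or no letter) are dominated by `ω₀ = 1/x` on `(0, 1)`. -/
theorem abs_lett_le_inv {o : Option ℚ} {x : ℝ} (hx : x ∈ Ioo (0:ℝ) 1)
    (ho : ∀ c, o = some c → c ≤ 0 ∨ 1 < c) : |lett o x| ≤ Kb o * (1 / x) := by
  have h1 : 1 ≤ 1 / x := by rw [le_div_iff₀ hx.1]; linarith [hx.2]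
  have hK := one_le_Kb o
  cases o with
  | none => simpa [Kb] using h1
  | some c =>
    rcases ho c rfl with hc | hc
    · have hc' : (c : ℝ) ≤ 0 := by exact_mod_cast hc
      calc |lett (some c) x| ≤ 1 / x :=
            abs_lett_some_le hx.1 (by rw [abs_of_pos (by linarith [hx.1])]; linarith)
        _ ≤ Kb (some c) * (1 / x) := le_mul_of_one_le_left (by positivity) hK
    · have hc' : (1 : ℝ) < c := by exact_mod_cast hc
      calc |lett (some c) x| ≤ 1 / ((c : ℝ) - 1) := abs_lett_some_le (by linarith)
              (by rw [abs_sub_comm, abs_of_pos (by linarith [hx.2])]; linarith [hx.2])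
        _ ≤ Kb (some c) := by simp [Kb]
        _ ≤ Kb (some c) * (1 / x) := le_mul_of_one_le_right (by linarith) h1

/-- Letters `c < 0` or `c ≥ 1` (or no letter) are dominated by `ω₁ = 1/(1 - x)` on `(0, 1)`. -/
theorem abs_lett_le_inv_one_sub {o : Option ℚ} {x : ℝ} (hx : x ∈ Ioo (0:ℝ) 1)
    (ho : ∀ c, o = some c → c < 0 ∨ 1 ≤ c) : |lett o x| ≤ Kb o * (1 / (1 - x)) := by
  have h1 : 1 ≤ 1 / (1 - x) := by rw [le_div_iff₀ (by linarith [hx.2])]; linarith [hx.1]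
  have hK := one_le_Kb o
  cases o with
  | none => simpa [Kb] using h1
  | some c =>
    rcases ho c rfl with hc | hc
    · have hc' : (c : ℝ) < 0 := by exact_mod_cast hc
      calc |lett (some c) x| ≤ 1 / (-(c : ℝ)) := abs_lett_some_le (by linarith)
              (by rw [abs_of_pos (by linarith [hx.1])]; linarith [hx.1])
        _ ≤ Kb (some c) := by simp [Kb]
        _ ≤ Kb (some c) * (1 / (1 - x)) := le_mul_of_one_le_right (by linarith) h1
    · have hc' : (1 : ℝ) ≤ c := by exact_mod_cast hc
      calc |lett (some c) x| ≤ 1 / (1 - x) := abs_lett_some_le (by linarith [hx.2])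
              (by rw [abs_sub_comm, abs_of_pos (by linarith [hx.2])]; linarith)
        _ ≤ Kb (some c) * (1 / (1 - x)) := le_mul_of_one_le_left (by positivity) hK

/-- Letters `c < 0` or `c > 1` (or no letter) are bounded on `(0, 1)`. -/
theorem abs_lett_le_Kb {o : Option ℚ} {x : ℝ} (hx : x ∈ Ioo (0:ℝ) 1)
    (ho : ∀ c, o = some c → c < 0 ∨ 1 < c) : |lett o x| ≤ Kb o := by
  cases o with
  | none => simp [Kb]
  | some c =>
    rcases ho c rfl with hc | hc
    · have hc' : (c : ℝ) < 0 := by exact_mod_cast hc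
      calc |lett (some c) x| ≤ 1 / (-(c : ℝ)) := abs_lett_some_le (by linarith)
              (by rw [abs_of_pos (by linarith [hx.1])]; linarith [hx.1])
        _ ≤ Kb (some c) := by simp [Kb]
    · have hc' : (1 : ℝ) < c := by exact_mod_cast hc
      calc |lett (some c) x| ≤ 1 / ((c : ℝ) - 1) := abs_lett_some_le (by linarith)
              (by rw [abs_sub_comm, abs_of_pos (by linarith [hx.2])]; linarith [hx.2])
        _ ≤ Kb (some c) := by simp [Kb]

/-- Factorwise domination of admissible data by the MZV pattern `epsOf a` (dimension `≥ 2`). -/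
theorem abs_lett_le_mzvForm {w : ℕ} {a : Fin w → Option ℚ} (ha : a ∈ Adm w)
    {t : Fin w → ℝ} (ht : t ∈ KZ.openOrderedSimplex w) (i : Fin w) :
    |lett (a i) (t i)| ≤ Kb (a i) * KZ.mzvForm (epsOf a i) (t i) := by
  have hx : t i ∈ Ioo (0:ℝ) 1 := ⟨ht.1 i, ht.2.1 i⟩
  have h0 : ∀ x, KZ.mzvForm false x = 1 / x := fun x => rfl
  have h1 : ∀ x, KZ.mzvForm true x = 1 / (1 - x) := fun x => rfl
  by_cases hbot : (i : ℕ) + 1 = w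
  · have he : epsOf a i = true := by simp [epsOf, hbot]
    rw [he, h1]
    refine abs_lett_le_inv_one_sub hx fun c hc => ?_
    rcases (ha i c hc).1 with h | h
    · exact Or.inl (lt_of_le_of_ne h ((ha i c hc).2.2 hbot))
    · exact Or.inr h
  by_cases htop : (i : ℕ) = 0
  · have he : epsOf a i = false := by
      have : (0 : ℕ) + 1 ≠ w := htop ▸ hbot
      simp [epsOf, htop]; omega
    rw [he, h0]
    refine abs_lett_le_inv hx fun c hc => ?_
    rcases (ha i c hc).1 with h | h
    · exact Or.inl h
    · exact Or.inr (lt_of_le_of_ne h (fun h' => (ha i c hc).2.1 htop h'.symm))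
  cases hai : a i with
  | none =>
    have he : epsOf a i = false := by simp [epsOf, hbot, htop, hai]
    rw [he, h0]
    exact abs_lett_le_inv hx (o := none) (by simp)
  | some c =>
    by_cases hc : 1 ≤ c
    · have he : epsOf a i = true := by simp [epsOf, hbot, htop, hai, hc]
      rw [he, h1]
      exact abs_lett_le_inv_one_sub hx (o := some c) (fun c' hc' => by cases hc'; exact Or.inr hc)
    · have hc0 : c ≤ 0 := ((ha i c hai).1.resolve_right hc)
      have he : epsOf a i = false := by simp [epsOf, hbot, htop, hai, hc]
      rw [he, h0]
      exact abs_lett_le_inv hx (o := some c) (fun c' hc' => by cases hc'; exact Or.inl hc0)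

/-- **Sufficiency of admissibility.** An admissible class integrand is absolutely integrable on the
open ordered simplex. -/
theorem integrableOn_cint {w : ℕ} (G : MvPolynomial (Fin w) ℚ) {a : Fin w → Option ℚ}
    (ha : a ∈ Adm w) : IntegrableOn (cint G a) (KZ.openOrderedSimplex w) := by
  obtain ⟨C, hC0, hC⟩ := exists_abs_aeval_le G
  have hmeas : AEStronglyMeasurable (cint G a) (volume.restrict (KZ.openOrderedSimplex w)) :=
    KZ.aestronglyMeasurable_of_isSemialgebraicFunOn
      (isSemialgebraicFunOn_cint G a (KZ.isSemialgebraic_openOrderedSimplex w)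
        fun t ht i => den_ne_zero_of_adm ha ht i) (KZ.measurableSet_openOrderedSimplex w)
  have hbound : ∀ t ∈ KZ.openOrderedSimplex w, ∀ g : Fin w → ℝ,
      (∀ i, |lett (a i) (t i)| ≤ g i) → ‖cint G a t‖ ≤ C * ∏ i, g i := fun t ht g hg => by
    rw [Real.norm_eq_abs, cint, abs_mul, Finset.abs_prod]
    exact mul_le_mul (hC t ht) (Finset.prod_le_prod (fun i _ => abs_nonneg _) fun i _ => hg i)
      (Finset.prod_nonneg fun i _ => abs_nonneg _) hC0
  rcases le_or_gt w 1 with hw | hw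
  · refine Integrable.mono' (integrableOn_const (unletter_volume_simplex_ne_top w)
      (C := C * ∏ i, Kb (a i))) hmeas ((ae_restrict_mem (KZ.measurableSet_openOrderedSimplex w)).mono
        fun t ht => hbound t ht _ fun i => abs_lett_le_Kb ⟨ht.1 i, ht.2.1 i⟩ fun c hc => ?_)
    have h0 : (i : ℕ) = 0 := by omega
    have h1 : (i : ℕ) + 1 = w := by omega
    rcases (ha i c hc).1 with h | h
    · exact Or.inl (lt_of_le_of_ne h ((ha i c hc).2.2 h1))
    · exact Or.inr (lt_of_le_of_ne h fun h' => (ha i c hc).2.1 h0 h'.symm)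
  · have hg : IntegrableOn (fun t : Fin w → ℝ => C * ∏ i, (Kb (a i) * KZ.mzvForm (epsOf a i) (t i)))
        (KZ.openOrderedSimplex w) := by
      have h : IntegrableOn (fun t : Fin w → ℝ => (C * ∏ i, Kb (a i)) *
          ∏ i : Fin w, KZ.mzvForm (epsOf a i) (t i)) (KZ.openOrderedSimplex w) :=
        (KZ.integrableOn_prod_mzvForm w (epsOf a) (fun _ => by simp [epsOf]; omega)
          (fun _ => by simp [epsOf, show w - 1 < w by omega]; omega)).const_mul (C * ∏ i, Kb (a i))
      refine h.congr_fun (fun t _ => ?_) (KZ.measurableSet_openOrderedSimplex w)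
      simp only [Finset.prod_mul_distrib]; ring
    exact hg.mono' hmeas ((ae_restrict_mem (KZ.measurableSet_openOrderedSimplex w)).mono
      fun t ht => hbound t ht _ fun i => abs_lett_le_mzvForm ha ht i)

/-! ### The formal primitive in the last variable -/

/-- Evaluation of a polynomial as the sum over its support of the monomial values. -/
theorem aeval_eq_sum_support {w : ℕ} (P : MvPolynomial (Fin w) ℚ) (y : Fin w → ℝ) :
    (aeval y P : ℝ) = ∑ m ∈ P.support, ((coeff m P : ℚ) : ℝ) * ∏ i, y i ^ (m i) := by
  conv_lhs => rw [P.as_sum]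
  rw [map_sum]
  refine Finset.sum_congr rfl fun m _ => ?_
  rw [aeval_monomial, Finsupp.prod_fintype _ _ fun i => pow_zero _]
  simp

/-- Fibrewise, the primitive `antider H` has derivative `H` along the last coordinate. -/
theorem hasDerivAt_aeval_antider {n : ℕ} (H : MvPolynomial (Fin (n + 1)) ℚ) (x : Fin n → ℝ)
    (t : ℝ) : HasDerivAt (fun s : ℝ => (aeval (Fin.snoc x s : Fin (n + 1) → ℝ) (antider H) : ℝ))
      (aeval (Fin.snoc x t : Fin (n + 1) → ℝ) H) t := by
  have key : ∀ (m : Fin (n + 1) →₀ ℕ) (s : ℝ), ∏ i, (Fin.snoc x s : Fin (n + 1) → ℝ) i ^ (m i) =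
      (∏ j : Fin n, x j ^ (m (Fin.castSucc j))) * s ^ (m (Fin.last n)) := fun m s => by
    rw [Fin.prod_univ_castSucc]; simp
  have key2 : ∀ (m : Fin (n + 1) →₀ ℕ) (j : Fin n),
      (m + Finsupp.single (Fin.last n) 1 : Fin (n + 1) →₀ ℕ) (Fin.castSucc j) = m (Fin.castSucc j) :=
    fun m j => by simp [Fin.ext_iff, (Fin.is_lt j).ne']
  have key3 : ∀ (m : Fin (n + 1) →₀ ℕ), (m + Finsupp.single (Fin.last n) 1 : Fin (n + 1) →₀ ℕ)
      (Fin.last n) = m (Fin.last n) + 1 := fun m => by simp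
  have hfun : (fun s : ℝ => (aeval (Fin.snoc x s : Fin (n + 1) → ℝ) (antider H) : ℝ)) = fun s =>
      ∑ m ∈ H.support, (((coeff m H : ℚ) : ℝ) / ((m (Fin.last n) : ℝ) + 1) *
        ∏ j : Fin n, x j ^ (m (Fin.castSucc j))) * s ^ (m (Fin.last n) + 1) := by
    ext s
    rw [antider, map_sum]
    refine Finset.sum_congr rfl fun m _ => ?_
    rw [aeval_monomial, Finsupp.prod_fintype _ _ fun i => pow_zero _, key]
    simp only [key2, key3, eq_ratCast, Rat.cast_div, Rat.cast_add, Rat.cast_natCast, Rat.cast_one]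
    ring
  rw [hfun, aeval_eq_sum_support H]
  refine HasDerivAt.fun_sum fun m _ => ?_
  have h := (hasDerivAt_pow (m (Fin.last n) + 1) t).const_mul
    (((coeff m H : ℚ) : ℝ) / ((m (Fin.last n) : ℝ) + 1) * ∏ j : Fin n, x j ^ (m (Fin.castSucc j)))
  refine h.congr_deriv ?_
  rw [key]
  have : ((m (Fin.last n) : ℝ) + 1) ≠ 0 := by positivity
  push_cast
  field_simp

/-- **Exact division after a Newton–Leibniz move**: `A - B ∣ H(X, A) - H(X, B)`. -/
theorem sub_dvd_bindSnoc_sub {n : ℕ} (H : MvPolynomial (Fin (n + 1)) ℚ)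
    (A B : MvPolynomial (Fin n) ℚ) :
    A - B ∣ bind₁ (Fin.snoc (fun i => X i) A : Fin (n + 1) → MvPolynomial (Fin n) ℚ) H -
      bind₁ (Fin.snoc (fun i => X i) B : Fin (n + 1) → MvPolynomial (Fin n) ℚ) H := by
  induction H using MvPolynomial.induction_on with
  | C a => simp
  | add p q hp hq =>
    have : bind₁ (Fin.snoc (fun i => X i) A : Fin (n + 1) → MvPolynomial (Fin n) ℚ) (p + q) -
        bind₁ (Fin.snoc (fun i => X i) B : Fin (n + 1) → MvPolynomial (Fin n) ℚ) (p + q) =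
        (bind₁ (Fin.snoc (fun i => X i) A : Fin (n + 1) → MvPolynomial (Fin n) ℚ) p -
          bind₁ (Fin.snoc (fun i => X i) B : Fin (n + 1) → MvPolynomial (Fin n) ℚ) p) +
        (bind₁ (Fin.snoc (fun i => X i) A : Fin (n + 1) → MvPolynomial (Fin n) ℚ) q -
          bind₁ (Fin.snoc (fun i => X i) B : Fin (n + 1) → MvPolynomial (Fin n) ℚ) q) := by
      simp only [map_add]; ring
    rw [this]
    exact dvd_add hp hq
  | mul_X p i hp =>
    simp only [map_mul, bind₁_X_right]
    have : bind₁ (Fin.snoc (fun i => X i) A : Fin (n + 1) → MvPolynomial (Fin n) ℚ) p *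
          (Fin.snoc (fun i => X i) A : Fin (n + 1) → MvPolynomial (Fin n) ℚ) i -
        bind₁ (Fin.snoc (fun i => X i) B : Fin (n + 1) → MvPolynomial (Fin n) ℚ) p *
          (Fin.snoc (fun i => X i) B : Fin (n + 1) → MvPolynomial (Fin n) ℚ) i =
        (bind₁ (Fin.snoc (fun i => X i) A : Fin (n + 1) → MvPolynomial (Fin n) ℚ) p -
          bind₁ (Fin.snoc (fun i => X i) B : Fin (n + 1) → MvPolynomial (Fin n) ℚ) p) *
          (Fin.snoc (fun i => X i) A : Fin (n + 1) → MvPolynomial (Fin n) ℚ) i +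
        bind₁ (Fin.snoc (fun i => X i) B : Fin (n + 1) → MvPolynomial (Fin n) ℚ) p *
          ((Fin.snoc (fun i => X i) A : Fin (n + 1) → MvPolynomial (Fin n) ℚ) i -
            (Fin.snoc (fun i => X i) B : Fin (n + 1) → MvPolynomial (Fin n) ℚ) i) := by ring
    rw [this]
    refine dvd_add (hp.mul_right _) (Dvd.dvd.mul_left ?_ _)
    induction i using Fin.lastCases with
    | last => simp
    | cast j => simp

end Unletter

end Summit.KontsevichZagierPeriods.ArrangementNormalForm.JanusBands
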